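import Literature.MathematicalPhysics.QuantumFieldTheory.Federbush1986.GoodSquareTranslatesScheme
import Literature.MathematicalPhysics.QuantumFieldTheory.Federbush1986.Regime2SfBridge

/-!
# Federbush [F3] §5.3 step 11) p. 305 — the s.f. hypothesis of (5.39)–(5.40) FROM THE SELECTION: in the group-generic scheme the
# slab between a kept bad square and one of its good translates consists of plaquettes with `|g_{∂p}| < a`

statement-level skeleton of published theorems with citation tags; proofs where landed; nothing here is a claim about the Yang–Mills mass gap

SOURCE. [Federbush1987PhaseCellIII] P. Federbush, *A phase cell approach to Yang–Mills theory III*, Commun. Math. Phys. **110**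
(1987) 293–309 (held `paper:url-4700a514f365`), p. 305 §5.3 11): *«Equations (5.39) and (5.40) are derived by relating the
contour BS to each of the BS_α by a sequence of elementary homotopies, and studying the change in assigned group elements as in the
analysis of Lemmas 5.4 and 5.5.»* — through s.f. plaquettes (Lemma 5.5 (5.12) p. 301).

CITATION HEADER (lean-in-tree rule).  lit-balaban cell (HOME `run/shared/lean/pub/lit-balaban/`), Phase-2 proof seat p26 (gen 16;
free-target protocol G.5-34(d)), SKELETON row **F3.Eq5.26-5.40** (owner r17, referee ref-5; head `typed`, unchanged).  One corollary
joining this seat's `GoodSquareTranslatesScheme.inBoxZ_slab` (the slab lies in the four blocks) with p32's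
`Regime2SfBridge.absG_plaqLoop_lt_of_not_mem` (p32 g13: a genuine plaquette of the four blocks not based at a removed base point is
s.f.): kept in its own file because `Regime2SfBridge`'s imports shadow `LatticeContour.Site` (written qualified here).  Companions
BY NAME (none edited): `ContourSlideHomotopy.dist_wordHol_slideWordN_le` / `SquareSlideChain` (consume the conclusion as `hsf`),
`GoodSquareTranslates.exists_goodTranslates_family` / `GoodSquareTranslatesScheme.exists_goodTranslates_idx` (produce the hypothesis
`hclean`).

WHAT IS PROVED: **`slab_sf`** — for a configuration `U : LocalStabilityG.Cfg G d N` all of whose fine plaquettes outside `LF` are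
s.f. (`dist 1 (plaqHol U j) < a`), squares `y`, `y + t e_{d+1}` of `block N 0` (`d ≧ 1`) and a slab `slabPlaqs e_{d+1} (rectLoop y
0 1 N N) t` with no plaquette based in `lfBases LF`: every slab plaquette has `|g_{∂p}| < a`.

HONEST SCOPE.  Assembly only; no `def`, no `sorry`; axioms standard.  Unit `lit-balaban-p26` (literature-prover-lit-balaban-p26-g16-0).
-/

namespace Literature.MathematicalPhysics.QuantumFieldTheory.Federbush1986

namespace GoodSquareTranslates

open LatticeContour
open Literature.MathematicalPhysics.QuantumFieldTheory.Balaban1983to89.B6Elimination (block mem_block)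

variable (d : ℕ) {G : Type} [Group G] [MetricSpace G] [IsIsometricSMul G G] [IsIsometricSMul Gᵐᵒᵖ G]

/-- **The s.f. input of (5.39)–(5.40) from the selection.**  In the scheme (`LocalStabilityG.Cfg`, every fine plaquette outside
the l.f. set `LF` s.f.), if the slab between the squares at `y` and `y + t e_{d+1}` (both in `block N 0`) has no plaquette based at
a removed base point (`lfBases LF` — the conclusion of `exists_goodTranslates_idx`/`exists_goodTranslates_family`), then EVERY slab
plaquette has `|g_{∂p}| < a`: the hypothesis `hsf` of `ContourSlideHomotopy.dist_wordHol_slideWordN_le` / `SquareSlideChain`.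
[cite: Federbush1987PhaseCellIII, §5.3 11) (5.39)–(5.40) p. 305; Lemma 5.5 (5.12) p. 301] -/
theorem slab_sf (hd : 1 ≤ d) {N : ℕ} (hN : 0 < N) (U : LocalStabilityG.Cfg G d N) {a : ℝ}
    (LF : Finset (LocalStabilitySU2D.Plaq d N)) (hU : ∀ j, j ∉ LF → dist 1 (LocalStabilityG.plaqHol d N hN U j) < a)
    {y : LatticeContour.Site (d + 2)} {t : ℕ} (hy : y ∈ block N (0 : LatticeContour.Site (d + 2)))
    (hyt : y + (t : ℤ) • ev (Fin.last (d + 1)) ∈ block N (0 : LatticeContour.Site (d + 2)))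
    (hclean : ∀ q ∈ slabPlaqs (Fin.last (d + 1)) (rectLoop y 0 1 N N) t, q.1 ∉ LocalStabilityG.lfBases d N LF) :
    ∀ q ∈ slabPlaqs (Fin.last (d + 1)) (rectLoop y 0 1 N N) t,
      absG (wordHol (LocalStabilityG.bondVar d N hN U) (plaqLoop q.1 q.2.1 q.2.2)) < a := by
  intro q hq
  obtain ⟨h1, h2, h3⟩ := inBoxZ_slab d hd hy hyt hq
  exact LocalStabilityG.absG_plaqLoop_lt_of_not_mem d N hN U LF hU (slabPlaqs_genuine _ _ t q hq) h1 h2 h3 (hclean q hq)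

end GoodSquareTranslates

end Literature.MathematicalPhysics.QuantumFieldTheory.Federbush1986
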